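import Literature.AlgebraicGeometry.ShimuraVarieties.UnitaryCurveConeExtension
import Mathlib.Analysis.Calculus.DiffContOnCl
import Mathlib.LinearAlgebra.FiniteDimensional.Lemmas
import Mathlib.Topology.Algebra.Module.FiniteDimension
import HarnessLib

/-!
# Frame coordinates of a rank-2 cone frame: the cone law factors a cone-holomorphic function through the DISC of negative lines

Topic `NumberTheory/Automorphic`; namespace `Literature.NumberTheory.Automorphic.UnitaryCurveForms` (the namespace of the rank-2 carriers ★
`UnitaryCurveCohCotangentForms`: `ConeFrame`, `IsConeHol`, `holCotForms₂`).  THEOREMS ONLY (no `def`, no instance, no notation, no named fact,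
no `sorry`); imports ★ `ShimuraVarieties/UnitaryCurveConeExtension` §1 (`form_v₀_ne_zero`, `form_t₀_ne_zero`; A-p14 (g16)) and Mathlib.

SETTING.  `E` a field, `J ∈ M₂(E)`, `w₁` a complex place, `Jw := σ_{w₁}J ∈ M₂(ℂ)`, `⟪x, y⟫ := xᴴ Jw y`, and a cone frame `𝔣 = (v₀, t₀)` of ★
`ConeFrame E J w₁` (`Re ⟪v₀,v₀⟫ < 0`, `Re ⟪t₀,t₀⟫ > 0`, `⟪t₀, v₀⟫ = 0`).  We do NOT assume `Jw` hermitian: the only extra hypothesis is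
`hvt : ⟪v₀, t₀⟫ = 0` (automatic for `Jw` hermitian — ★ `UnitaryCurveCone.form_v₀_t₀` — and for `Jw` hermitian up to a scalar, which is the case
`J = H`, `t • H` `c`-hermitian, of the P5 letter ★ `UnitaryCurveForms.holCotFormSpectralProjection₂`).  This is the first of three files building
the CHART-FREE REPRODUCING KERNEL for cone-holomorphic cotangent-type functions on `U(Jw) ≤ GL₂(ℂ)` (sequel files `UnitaryCurveConeFrameTorus`,
`UnitaryCurveConeReproducingKernel`); no disc MODEL of `U(1,1)` is used anywhere — the frame itself supplies the disc coordinate.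

MAIN RESULTS.
* §1 `exists_frameFunctionals` — `ℂ`-linear `πt, πv` with `w = πt w • t₀ + πv w • v₀` (the frame is a basis: `frame_linearIndependent`);
  `frameFunctionals_eq` ∕ `_frame` (reading off coordinates), `eq_of_mulVec_frame` (matrices are determined by the frame),
  `exists_matrix_frame_action` (prescribed action on the frame), `isUnit_form_of_orth` (`Jw` is invertible), `form_frame_combination`,
  `form_line` (`⟪ζ t₀ + v₀, ζ t₀ + v₀⟫ = ⟪v₀,v₀⟫ + |ζ|² ⟪t₀,t₀⟫`), `line_mem_negCone_of_norm_le`, **`mem_frameDisc_iff`** (the frame disc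
  `{ζ | ζ t₀ + v₀ negative}` is the round disc `|ζ| < r₀`, `r₀² = −Re⟪v₀,v₀⟫ ∕ Re⟪t₀,t₀⟫`), `frameCoord_v₀_ne_zero_of_mem_negCone`.
* §2 `exists_frameNilpotent` (`N v₀ = t₀`, `N t₀ = 0`, `N² = 0`), the unipotent line `g(ζ) = 1 + ζ N` (`line_mul_line`, `isUnit_line`,
  `line_mulVec_v₀ ∕ _t₀`) and the **KEY FORMULA `IsConeHol.apply_eq_factor_mul_apply_line`**: for `Φ` obeying the cotangent LAW of ★ `IsConeHol 𝔣`
  and `h v₀` negative, with frame coordinates `h v₀ = y t₀ + x v₀`, `h t₀ = y′ t₀ + x′ v₀`: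
  `Φ(h) = ((x y′ − x′ y) ∕ x²) · Φ(1 + (y∕x) N)` — `Φ` is the cotangent automorphy factor times a function of the DISC COORDINATE `ζ(h) = y∕x`
  of the negative line `h[v₀]`.
* §3 `IsConeHol.differentiableOn_line` ∕ `diffContOnCl_line` — `F(ζ) := Φ(1 + ζ N)` is holomorphic on the frame disc (clause 1 of ★ `IsConeHol`
  along an affine line), `DiffContOnCl` on the closed discs inside it (the hypothesis of Mathlib's circle mean value theorem).
* §4 `contDiff_frameCoord` ∕ `continuous_frameCoord` (the coordinates are `ℂ`-linear, hence smooth), `frameDet_ne_zero` (an invertible matrix has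
  non-zero frame determinant `x y′ − x′ y`).
Borel (1997) §5.13–§5.14 (weight-`m` automorphy factor on the disc ∕ functions on the group); Bergeron–Millson–Moeglin (2016) Part 2 §1.3 (negative
lines).  A Summits-side twin of §1–§2 for the K-E₂ lane is ★ `Theorems/HLiu418E2DiscSlice` (F0P5-p02 (g2); slice `s(z) = 1 + zN`, same
hypothesis `hvt`); here the results live in Literature for the TP₂ (spectral projection) lane and go on to holomorphy and the kernel.  Cell
`hodgecm-mathlib`, floor 0, K-groundwork for the P5 named fact TP₂ (`Lines/F0_P5TP2SpectralProjection`, stub (K₂)); seat F0P5-p01 (g2).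
HC_CM is proved only modulo the printed citations until rung 0 closes; nothing printed is asserted here.

## References
* [Borel1997] A. Borel, *Automorphic forms on SL₂(ℝ)*, Cambridge Tracts in Math. 130 (1997), §5.13–§5.14.
* [BergeronMillsonMoeglin2016Balls] N. Bergeron, J. Millson, C. Moeglin, Acta Math. 216 (2016), Part 2 §1.3.
* [Jacobson] N. Jacobson, *Basic Algebra I*, 2nd ed. (1985), Ch. V §7 (hermitian forms, orthogonal bases).
-/

set_option autoImplicit false

noncomputable section

open Matrix MeasureTheory NumberField NumberField.InfinitePlace
open scoped Matrix ComplexConjugate ComplexOrder ContDiff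
open Literature.NumberTheory.Automorphic Literature.NumberTheory.Automorphic.UnitaryGroup
open Literature.AlgebraicGeometry.ShimuraVarieties Literature.AlgebraicGeometry.ShimuraVarieties.UnitaryCurveCone

namespace Literature.NumberTheory.Automorphic.UnitaryCurveForms

variable {E : Type} [Field E] {J : Matrix (Fin 2) (Fin 2) E} {w₁ : {w : InfinitePlace E // IsComplex w}}
  (𝔣 : ConeFrame E J w₁)

/-! ## §1 Frame coordinate functionals (no hermitian symmetry: only `⟪v₀, t₀⟫ = 0` is assumed)

Throughout, `⟪x, y⟫ := xᴴ · σ_{w₁}(J) · y` and `hvt : ⟪v₀, t₀⟫ = 0` (the frame carries `⟪t₀, v₀⟫ = 0`; for `σ_{w₁}J` hermitian — or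
hermitian up to a scalar, as for the `J = H`, `t • H` `c`-hermitian, of the P5 letters — `hvt` follows: ★ `UnitaryCurveCone.form_v₀_t₀`). -/

/-- The hermitian-type form on frame combinations: `⟪a t₀ + d v₀, a′ t₀ + d′ v₀⟫ = ā a′ ⟪t₀,t₀⟫ + d̄ d′ ⟪v₀,v₀⟫`.
[cite: BergeronMillsonMoeglin2016Balls, Part 2 §1.3] -/
theorem form_frame_combination (hvt : star 𝔣.v₀ ⬝ᵥ (J.map w₁.1.embedding *ᵥ 𝔣.t₀) = 0) (a d a' d' : ℂ) :
    star (a • 𝔣.t₀ + d • 𝔣.v₀) ⬝ᵥ (J.map w₁.1.embedding *ᵥ (a' • 𝔣.t₀ + d' • 𝔣.v₀)) =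
      starRingEnd ℂ a * a' * (star 𝔣.t₀ ⬝ᵥ (J.map w₁.1.embedding *ᵥ 𝔣.t₀)) +
        starRingEnd ℂ d * d' * (star 𝔣.v₀ ⬝ᵥ (J.map w₁.1.embedding *ᵥ 𝔣.v₀)) := by
  simp only [mulVec_add, mulVec_smul, star_add, star_smul, add_dotProduct, smul_dotProduct, dotProduct_add,
    dotProduct_smul, 𝔣.orth, hvt, smul_eq_mul, mul_zero, add_zero, zero_add, Complex.star_def]
  ring

/-- The frame `(t₀, v₀)` is linearly independent (pair with `t₀ᴴ σJ` and `v₀ᴴ σJ`). [cite: BergeronMillsonMoeglin2016Balls, Part 2 §1.3] -/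
theorem frame_linearIndependent (hvt : star 𝔣.v₀ ⬝ᵥ (J.map w₁.1.embedding *ᵥ 𝔣.t₀) = 0) :
    LinearIndependent ℂ ![𝔣.t₀, 𝔣.v₀] := by
  rw [LinearIndependent.pair_iff]
  intro a d h
  have h1 : star 𝔣.t₀ ⬝ᵥ (J.map w₁.1.embedding *ᵥ (a • 𝔣.t₀ + d • 𝔣.v₀)) =
      a * (star 𝔣.t₀ ⬝ᵥ (J.map w₁.1.embedding *ᵥ 𝔣.t₀)) := by
    have := form_frame_combination 𝔣 hvt 1 0 a d
    simp only [one_smul, zero_smul, add_zero, map_one, one_mul, map_zero, zero_mul, add_zero] at this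
    exact this
  have h2 : star 𝔣.v₀ ⬝ᵥ (J.map w₁.1.embedding *ᵥ (a • 𝔣.t₀ + d • 𝔣.v₀)) =
      d * (star 𝔣.v₀ ⬝ᵥ (J.map w₁.1.embedding *ᵥ 𝔣.v₀)) := by
    have := form_frame_combination 𝔣 hvt 0 1 a d
    simp only [one_smul, zero_smul, zero_add, map_one, one_mul, map_zero, zero_mul, zero_add] at this
    exact this
  rw [h, mulVec_zero, dotProduct_zero] at h1 h2
  exact ⟨(mul_eq_zero.1 h1.symm).resolve_right (form_t₀_ne_zero 𝔣),
    (mul_eq_zero.1 h2.symm).resolve_right (form_v₀_ne_zero 𝔣)⟩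

/-- **Frame coordinate functionals.**  `(t₀, v₀)` is a basis of `ℂ²`, so there are `ℂ`-linear functionals `πt, πv` with
`w = πt w • t₀ + πv w • v₀` for every `w`. [cite: BergeronMillsonMoeglin2016Balls, Part 2 §1.3] -/
theorem exists_frameFunctionals (hvt : star 𝔣.v₀ ⬝ᵥ (J.map w₁.1.embedding *ᵥ 𝔣.t₀) = 0) :
    ∃ πt πv : (Fin 2 → ℂ) →ₗ[ℂ] ℂ, ∀ w, w = πt w • 𝔣.t₀ + πv w • 𝔣.v₀ := by
  have hcard : Fintype.card (Fin 2) = Module.finrank ℂ (Fin 2 → ℂ) := by simp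
  let B := basisOfLinearIndependentOfCardEqFinrank (frame_linearIndependent 𝔣 hvt) hcard
  have hB0 : B 0 = 𝔣.t₀ := by simp [B]
  have hB1 : B 1 = 𝔣.v₀ := by simp [B]
  refine ⟨B.coord 0, B.coord 1, fun w => ?_⟩
  have h := B.sum_repr w
  rw [Fin.sum_univ_two, hB0, hB1] at h
  exact h.symm

variable {𝔣}

/-- Reading off frame coordinates: if `w = a • t₀ + d • v₀` then `πt w = a` and `πv w = d`.
[cite: BergeronMillsonMoeglin2016Balls, Part 2 §1.3] -/
theorem frameFunctionals_eq (hvt : star 𝔣.v₀ ⬝ᵥ (J.map w₁.1.embedding *ᵥ 𝔣.t₀) = 0) {πt πv : (Fin 2 → ℂ) →ₗ[ℂ] ℂ}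
    (hdec : ∀ w, w = πt w • 𝔣.t₀ + πv w • 𝔣.v₀) {w : Fin 2 → ℂ} {a d : ℂ} (hw : w = a • 𝔣.t₀ + d • 𝔣.v₀) :
    πt w = a ∧ πv w = d := by
  have h0 : (πt w - a) • 𝔣.t₀ + (πv w - d) • 𝔣.v₀ = 0 := by
    rw [sub_smul, sub_smul]
    have h1 : πt w • 𝔣.t₀ + πv w • 𝔣.v₀ = a • 𝔣.t₀ + d • 𝔣.v₀ := (hdec w).symm.trans hw
    calc πt w • 𝔣.t₀ - a • 𝔣.t₀ + (πv w • 𝔣.v₀ - d • 𝔣.v₀)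
        = (πt w • 𝔣.t₀ + πv w • 𝔣.v₀) - (a • 𝔣.t₀ + d • 𝔣.v₀) := by abel
      _ = 0 := by rw [h1, sub_self]
  have := (LinearIndependent.pair_iff.1 (frame_linearIndependent 𝔣 hvt)) _ _ h0
  exact ⟨sub_eq_zero.1 this.1, sub_eq_zero.1 this.2⟩

/-- The functionals on the frame: `πt t₀ = 1`, `πv t₀ = 0`, `πt v₀ = 0`, `πv v₀ = 1`.
[cite: BergeronMillsonMoeglin2016Balls, Part 2 §1.3] -/
theorem frameFunctionals_frame (hvt : star 𝔣.v₀ ⬝ᵥ (J.map w₁.1.embedding *ᵥ 𝔣.t₀) = 0) {πt πv : (Fin 2 → ℂ) →ₗ[ℂ] ℂ}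
    (hdec : ∀ w, w = πt w • 𝔣.t₀ + πv w • 𝔣.v₀) :
    πt 𝔣.t₀ = 1 ∧ πv 𝔣.t₀ = 0 ∧ πt 𝔣.v₀ = 0 ∧ πv 𝔣.v₀ = 1 := by
  have h1 := frameFunctionals_eq hvt hdec (w := 𝔣.t₀) (a := 1) (d := 0) (by simp)
  have h2 := frameFunctionals_eq hvt hdec (w := 𝔣.v₀) (a := 0) (d := 1) (by simp)
  exact ⟨h1.1, h1.2, h2.1, h2.2⟩

/-- **Matrices are determined by their action on the frame** (a basis). [cite: Jacobson, Ch. V §7 pp. 150–151] -/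
theorem eq_of_mulVec_frame {πt πv : (Fin 2 → ℂ) →ₗ[ℂ] ℂ} (hdec : ∀ w, w = πt w • 𝔣.t₀ + πv w • 𝔣.v₀)
    {M M' : Matrix (Fin 2) (Fin 2) ℂ} (hv : M *ᵥ 𝔣.v₀ = M' *ᵥ 𝔣.v₀) (ht : M *ᵥ 𝔣.t₀ = M' *ᵥ 𝔣.t₀) : M = M' := by
  have h : ∀ w, M *ᵥ w = M' *ᵥ w := fun w => by
    rw [hdec w, mulVec_add, mulVec_add, mulVec_smul, mulVec_smul, mulVec_smul, mulVec_smul, hv, ht]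
  ext i j
  simpa only [mulVec_single_one, Matrix.col_apply] using congrFun (h (Pi.single j 1)) i

/-- **A matrix with prescribed action on the frame**: `Y v₀ = α t₀ + β v₀`, `Y t₀ = α′ t₀ + β′ v₀` (two rank-one pieces through the
functionals `⟪v₀, ·⟫∕⟪v₀,v₀⟫` and `⟪t₀, ·⟫∕⟪t₀,t₀⟫`). [cite: Jacobson, Ch. V §7 pp. 150–151] -/
theorem exists_matrix_frame_action (hvt : star 𝔣.v₀ ⬝ᵥ (J.map w₁.1.embedding *ᵥ 𝔣.t₀) = 0) (α β α' β' : ℂ) :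
    ∃ Y : Matrix (Fin 2) (Fin 2) ℂ, Y *ᵥ 𝔣.v₀ = α • 𝔣.t₀ + β • 𝔣.v₀ ∧ Y *ᵥ 𝔣.t₀ = α' • 𝔣.t₀ + β' • 𝔣.v₀ := by
  set Jw := J.map w₁.1.embedding with hJw
  set cv : ℂ := (star 𝔣.v₀ ⬝ᵥ (Jw *ᵥ 𝔣.v₀))⁻¹
  set ct : ℂ := (star 𝔣.t₀ ⬝ᵥ (Jw *ᵥ 𝔣.t₀))⁻¹
  have htv : star 𝔣.t₀ ⬝ᵥ (Jw *ᵥ 𝔣.v₀) = 0 := 𝔣.orth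
  have key : ∀ (a : Fin 2 → ℂ) (b w : Fin 2 → ℂ), vecMulVec a b *ᵥ w = (b ⬝ᵥ w) • a := fun a b w => by
    rw [vecMulVec_mulVec, op_smul_eq_smul]
  refine ⟨vecMulVec (α • 𝔣.t₀ + β • 𝔣.v₀) (cv • (star 𝔣.v₀ ᵥ* Jw)) +
    vecMulVec (α' • 𝔣.t₀ + β' • 𝔣.v₀) (ct • (star 𝔣.t₀ ᵥ* Jw)), ?_, ?_⟩
  · rw [add_mulVec, key, key, smul_dotProduct, smul_dotProduct, ← dotProduct_mulVec, ← dotProduct_mulVec, htv,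
      smul_zero, zero_smul, add_zero, smul_eq_mul, inv_mul_cancel₀ (form_v₀_ne_zero 𝔣), one_smul]
  · rw [add_mulVec, key, key, smul_dotProduct, smul_dotProduct, ← dotProduct_mulVec, ← dotProduct_mulVec, hvt,
      smul_zero, zero_smul, zero_add, smul_eq_mul, inv_mul_cancel₀ (form_t₀_ne_zero 𝔣), one_smul]

/-- **`σ_{w₁}J` is invertible** when it carries a cone frame with `⟪v₀,t₀⟫ = 0` (non-degeneracy on the basis `(t₀, v₀)`).
[cite: Jacobson, Ch. V §7 pp. 150–151] -/
theorem isUnit_form_of_orth (hvt : star 𝔣.v₀ ⬝ᵥ (J.map w₁.1.embedding *ᵥ 𝔣.t₀) = 0) :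
    IsUnit (J.map w₁.1.embedding) := by
  obtain ⟨πt, πv, hdec⟩ := exists_frameFunctionals 𝔣 hvt
  rw [← Matrix.mulVec_injective_iff_isUnit]
  intro w w' hww'
  rw [← sub_eq_zero] at hww' ⊢
  rw [← mulVec_sub] at hww'
  set u := w - w'
  have h := form_frame_combination 𝔣 hvt 1 0 (πt u) (πv u)
  have h' := form_frame_combination 𝔣 hvt 0 1 (πt u) (πv u)
  rw [← hdec u] at h h'
  simp only [one_smul, zero_smul, add_zero, zero_add, map_one, one_mul, map_zero, zero_mul, hww', dotProduct_zero]
    at h h'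
  have ht0 : πt u = 0 := (mul_eq_zero.1 h.symm).resolve_right (form_t₀_ne_zero 𝔣)
  have hv0 : πv u = 0 := (mul_eq_zero.1 h'.symm).resolve_right (form_v₀_ne_zero 𝔣)
  rw [hdec u, ht0, hv0, zero_smul, zero_smul, add_zero]

/-- `⟪ζ t₀ + v₀, ζ t₀ + v₀⟫ = ⟪v₀,v₀⟫ + |ζ|² ⟪t₀,t₀⟫`. [cite: BergeronMillsonMoeglin2016Balls, Part 2 §1.3] -/
theorem form_line (hvt : star 𝔣.v₀ ⬝ᵥ (J.map w₁.1.embedding *ᵥ 𝔣.t₀) = 0) (ζ : ℂ) :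
    star (ζ • 𝔣.t₀ + (1 : ℂ) • 𝔣.v₀) ⬝ᵥ (J.map w₁.1.embedding *ᵥ (ζ • 𝔣.t₀ + (1 : ℂ) • 𝔣.v₀)) =
      star 𝔣.v₀ ⬝ᵥ (J.map w₁.1.embedding *ᵥ 𝔣.v₀) +
        ((‖ζ‖ ^ 2 : ℝ) : ℂ) * (star 𝔣.t₀ ⬝ᵥ (J.map w₁.1.embedding *ᵥ 𝔣.t₀)) := by
  rw [form_frame_combination 𝔣 hvt, Complex.conj_mul', map_one, one_mul, one_mul, add_comm]
  push_cast
  ring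

/-- Monotonicity of negativity along the line `ζ t₀ + v₀`: if `ζ₀ t₀ + v₀` is negative and `|ζ| ≤ |ζ₀|`, so is `ζ t₀ + v₀`
(`Re ⟪t₀,t₀⟫ > 0`). [cite: BergeronMillsonMoeglin2016Balls, Part 2 §1.3] -/
theorem line_mem_negCone_of_norm_le (hvt : star 𝔣.v₀ ⬝ᵥ (J.map w₁.1.embedding *ᵥ 𝔣.t₀) = 0) {ζ ζ₀ : ℂ}
    (h₀ : ζ₀ • 𝔣.t₀ + (1 : ℂ) • 𝔣.v₀ ∈ negCone (J.map w₁.1.embedding)) (hle : ‖ζ‖ ≤ ‖ζ₀‖) :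
    ζ • 𝔣.t₀ + (1 : ℂ) • 𝔣.v₀ ∈ negCone (J.map w₁.1.embedding) := by
  rw [mem_negCone_iff, form_line hvt] at h₀ ⊢
  have ht : 0 < (star 𝔣.t₀ ⬝ᵥ (J.map w₁.1.embedding *ᵥ 𝔣.t₀)).re := 𝔣.t₀_pos
  simp only [Complex.add_re, Complex.mul_re, Complex.ofReal_re, Complex.ofReal_im, zero_mul, sub_zero] at h₀ ⊢
  have hsq : ‖ζ‖ ^ 2 ≤ ‖ζ₀‖ ^ 2 := by gcongr
  nlinarith [mul_le_mul_of_nonneg_right hsq ht.le]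

/-- **The frame disc is the round disc `|ζ| < r₀`**, `r₀² = −Re⟪v₀,v₀⟫ ∕ Re⟪t₀,t₀⟫`. [cite: BergeronMillsonMoeglin2016Balls, Part 2 §1.3] -/
theorem mem_frameDisc_iff (hvt : star 𝔣.v₀ ⬝ᵥ (J.map w₁.1.embedding *ᵥ 𝔣.t₀) = 0) (ζ : ℂ) :
    ζ • 𝔣.t₀ + (1 : ℂ) • 𝔣.v₀ ∈ negCone (J.map w₁.1.embedding) ↔
      ‖ζ‖ < Real.sqrt (-(star 𝔣.v₀ ⬝ᵥ (J.map w₁.1.embedding *ᵥ 𝔣.v₀)).re /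
        (star 𝔣.t₀ ⬝ᵥ (J.map w₁.1.embedding *ᵥ 𝔣.t₀)).re) := by
  have ht : 0 < (star 𝔣.t₀ ⬝ᵥ (J.map w₁.1.embedding *ᵥ 𝔣.t₀)).re := 𝔣.t₀_pos
  rw [mem_negCone_iff, form_line hvt, Real.lt_sqrt (norm_nonneg _), lt_div_iff₀ ht]
  simp only [Complex.add_re, Complex.mul_re, Complex.ofReal_re, Complex.ofReal_im, zero_mul, sub_zero]
  constructor <;> intro h <;> linarith

/-- The frame disc `{ζ | ζ t₀ + v₀ negative}` is open. [cite: BergeronMillsonMoeglin2016Balls, Part 2 §1.3] -/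
theorem isOpen_frameDisc :
    IsOpen {ζ : ℂ | ζ • 𝔣.t₀ + (1 : ℂ) • 𝔣.v₀ ∈ negCone (J.map w₁.1.embedding)} :=
  (isOpen_negCone _).preimage ((continuous_id.smul continuous_const).add continuous_const)

/-- The `v₀`-coordinate of a NEGATIVE vector is non-zero (a multiple of the positive `t₀` is not negative).
[cite: BergeronMillsonMoeglin2016Balls, Part 2 §1.3] -/
theorem frameCoord_v₀_ne_zero_of_mem_negCone (hvt : star 𝔣.v₀ ⬝ᵥ (J.map w₁.1.embedding *ᵥ 𝔣.t₀) = 0)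
    {πt πv : (Fin 2 → ℂ) →ₗ[ℂ] ℂ} (hdec : ∀ w, w = πt w • 𝔣.t₀ + πv w • 𝔣.v₀) {w : Fin 2 → ℂ}
    (hw : w ∈ negCone (J.map w₁.1.embedding)) : πv w ≠ 0 := by
  intro h0
  rw [mem_negCone_iff, hdec w, h0, form_frame_combination 𝔣 hvt, Complex.conj_mul', ← Complex.ofReal_pow] at hw
  simp only [map_zero, zero_mul, add_zero, Complex.mul_re, Complex.ofReal_re, Complex.ofReal_im, zero_mul, sub_zero]
    at hw
  have ht : 0 < (star 𝔣.t₀ ⬝ᵥ (J.map w₁.1.embedding *ᵥ 𝔣.t₀)).re := 𝔣.t₀_pos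
  nlinarith [sq_nonneg ‖πt w‖, mul_nonneg (sq_nonneg ‖πt w‖) ht.le]

/-! ## §2 The cone law factors a cone-holomorphic function through the disc of negative lines -/

/-- **The nilpotent of the frame**: `N v₀ = t₀`, `N t₀ = 0`, `N² = 0`. [cite: Borel1997, §5.13] -/
theorem exists_frameNilpotent (hvt : star 𝔣.v₀ ⬝ᵥ (J.map w₁.1.embedding *ᵥ 𝔣.t₀) = 0) :
    ∃ N : Matrix (Fin 2) (Fin 2) ℂ, N *ᵥ 𝔣.v₀ = 𝔣.t₀ ∧ N *ᵥ 𝔣.t₀ = 0 ∧ N * N = 0 := by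
  obtain ⟨πt, πv, hdec⟩ := exists_frameFunctionals 𝔣 hvt
  obtain ⟨N, hNv, hNt⟩ := exists_matrix_frame_action (𝔣 := 𝔣) hvt 1 0 0 0
  simp only [one_smul, zero_smul, add_zero] at hNv hNt
  refine ⟨N, hNv, hNt, eq_of_mulVec_frame hdec ?_ ?_⟩
  · rw [← mulVec_mulVec, hNv, hNt, zero_mulVec]
  · rw [← mulVec_mulVec, hNt, mulVec_zero, zero_mulVec]

/-- The unipotent line `g(ζ) = 1 + ζ N` is a one-parameter group: `g(ζ) g(ζ′) = g(ζ + ζ′)`. [cite: Borel1997, §5.13] -/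
theorem line_mul_line {N : Matrix (Fin 2) (Fin 2) ℂ} (hNN : N * N = 0) (ζ ζ' : ℂ) :
    (1 + ζ • N) * (1 + ζ' • N) = 1 + (ζ + ζ') • N := by
  rw [add_mul, one_mul, mul_add, mul_one, Matrix.smul_mul, Matrix.mul_smul, smul_smul, hNN, smul_zero, add_zero,
    add_smul]
  abel

/-- `g(ζ) = 1 + ζ N` is invertible with inverse `g(−ζ)`. [cite: Borel1997, §5.13] -/
theorem isUnit_line {N : Matrix (Fin 2) (Fin 2) ℂ} (hNN : N * N = 0) (ζ : ℂ) : IsUnit (1 + ζ • N) :=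
  (⟨1 + ζ • N, 1 + (-ζ) • N, by rw [line_mul_line hNN, add_neg_cancel, zero_smul, add_zero],
    by rw [line_mul_line hNN, neg_add_cancel, zero_smul, add_zero]⟩ : (Matrix (Fin 2) (Fin 2) ℂ)ˣ).isUnit

/-- `g(ζ) v₀ = ζ • t₀ + 1 • v₀`. [cite: Borel1997, §5.13] -/
theorem line_mulVec_v₀ {N : Matrix (Fin 2) (Fin 2) ℂ} (hNv : N *ᵥ 𝔣.v₀ = 𝔣.t₀) (ζ : ℂ) :
    (1 + ζ • N) *ᵥ 𝔣.v₀ = ζ • 𝔣.t₀ + (1 : ℂ) • 𝔣.v₀ := by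
  rw [add_mulVec, one_mulVec, smul_mulVec, hNv, one_smul, add_comm]

/-- `g(ζ) t₀ = 1 • t₀ + 0 • v₀`. [cite: Borel1997, §5.13] -/
theorem line_mulVec_t₀ {N : Matrix (Fin 2) (Fin 2) ℂ} (hNt : N *ᵥ 𝔣.t₀ = 0) (ζ : ℂ) :
    (1 + ζ • N) *ᵥ 𝔣.t₀ = (1 : ℂ) • 𝔣.t₀ + (0 : ℂ) • 𝔣.v₀ := by
  rw [add_mulVec, one_mulVec, smul_mulVec, hNt, smul_zero, add_zero, one_smul, zero_smul, add_zero]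

/-- **KEY FORMULA — the cone law factors `Φ` through the disc.**  For a cone-holomorphic `Φ` (only the cotangent LAW of ★
`IsConeHol` is used) and any `h` with `h v₀` NEGATIVE (invertibility of `h` is not needed), with frame coordinates `h v₀ = y t₀ + x v₀`,
`h t₀ = y′ t₀ + x′ v₀`:  `Φ(h) = ((x y′ − x′ y) ∕ x²) · Φ(1 + (y∕x) N)` — i.e. `Φ(h) = λ(h) F(ζ(h))` with `ζ(h) = y∕x` the disc
coordinate of the negative line `h[v₀]`, `F(ζ) = Φ(g(ζ))` and `λ` the cotangent automorphy factor (`h = g(ζ) · b`, `b = g(−ζ) h`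
stabilises `ℂ v₀` with coordinates `k = x`, `a = y′ − x′ζ`). [cite: Borel1997, §5.13–§5.14] -/
theorem IsConeHol.apply_eq_factor_mul_apply_line (hvt : star 𝔣.v₀ ⬝ᵥ (J.map w₁.1.embedding *ᵥ 𝔣.t₀) = 0)
    {πt πv : (Fin 2 → ℂ) →ₗ[ℂ] ℂ} (hdec : ∀ w, w = πt w • 𝔣.t₀ + πv w • 𝔣.v₀)
    {N : Matrix (Fin 2) (Fin 2) ℂ} (hNv : N *ᵥ 𝔣.v₀ = 𝔣.t₀) (hNt : N *ᵥ 𝔣.t₀ = 0) (hNN : N * N = 0)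
    {Φ : Matrix (Fin 2) (Fin 2) ℂ → ℂ} (hΦ : IsConeHol 𝔣 Φ) {h : Matrix (Fin 2) (Fin 2) ℂ}
    (hneg : h *ᵥ 𝔣.v₀ ∈ negCone (J.map w₁.1.embedding)) :
    Φ h = ((πv (h *ᵥ 𝔣.v₀) * πt (h *ᵥ 𝔣.t₀) - πv (h *ᵥ 𝔣.t₀) * πt (h *ᵥ 𝔣.v₀)) / (πv (h *ᵥ 𝔣.v₀)) ^ 2) *
      Φ (1 + (πt (h *ᵥ 𝔣.v₀) / πv (h *ᵥ 𝔣.v₀)) • N) := by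
  set x := πv (h *ᵥ 𝔣.v₀) with hx
  set y := πt (h *ᵥ 𝔣.v₀) with hy
  set x' := πv (h *ᵥ 𝔣.t₀) with hx'
  set y' := πt (h *ᵥ 𝔣.t₀) with hy'
  have hx0 : x ≠ 0 := frameCoord_v₀_ne_zero_of_mem_negCone hvt hdec hneg
  set ζ := y / x with hζ
  have hgv := line_mulVec_v₀ (𝔣 := 𝔣) hNv ζ
  have hgu : IsUnit (1 + ζ • N) := isUnit_line hNN ζ
  -- the cofactor `b := g(-ζ) h`
  have hhv : h *ᵥ 𝔣.v₀ = y • 𝔣.t₀ + x • 𝔣.v₀ := hdec _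
  have hht : h *ᵥ 𝔣.t₀ = y' • 𝔣.t₀ + x' • 𝔣.v₀ := hdec _
  have hbv : ((1 + (-ζ) • N) * h) *ᵥ 𝔣.v₀ = x • 𝔣.v₀ := by
    rw [← mulVec_mulVec, hhv, mulVec_add, mulVec_smul, mulVec_smul, line_mulVec_v₀ hNv, line_mulVec_t₀ hNt]
    have : y + x * -ζ = 0 := by rw [hζ]; field_simp; ring
    simp only [smul_add, smul_smul, mul_one, zero_smul, add_zero]
    rw [show y • 𝔣.t₀ + ((x * -ζ) • 𝔣.t₀ + x • 𝔣.v₀) = (y + x * -ζ) • 𝔣.t₀ + x • 𝔣.v₀ by rw [add_smul, add_assoc],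
      this, zero_smul, zero_add]
  have hbt : ((1 + (-ζ) • N) * h) *ᵥ 𝔣.t₀ = (y' + x' * -ζ) • 𝔣.t₀ + x' • 𝔣.v₀ := by
    rw [← mulVec_mulVec, hht, mulVec_add, mulVec_smul, mulVec_smul, line_mulVec_v₀ hNv, line_mulVec_t₀ hNt]
    simp only [smul_add, smul_smul, mul_one, zero_smul, add_zero]
    rw [add_smul, add_assoc]
  have hgneg : (1 + ζ • N) *ᵥ 𝔣.v₀ ∈ negCone (J.map w₁.1.embedding) := by
    have : (1 + ζ • N) *ᵥ 𝔣.v₀ = x⁻¹ • (h *ᵥ 𝔣.v₀) := by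
      rw [hgv, hhv, smul_add, smul_smul, smul_smul, inv_mul_cancel₀ hx0, hζ, div_eq_inv_mul]
    rw [this]
    exact smul_mem_negCone (inv_ne_zero hx0) hneg
  have hlaw := hΦ.2 (1 + ζ • N) ((1 + (-ζ) • N) * h) (y' + x' * -ζ) x x' hgu hgneg hx0 hbv hbt
  rw [← mul_assoc, line_mul_line hNN, add_neg_cancel, zero_smul, add_zero, one_mul] at hlaw
  rw [hlaw, hζ]
  congr 1
  field_simp
  ring


/-! ## §3 Holomorphy on the disc of the frame -/

/-- **`F(ζ) := Φ(1 + ζ N)` is HOLOMORPHIC on the disc of the frame** (clause 1 of ★ `IsConeHol` composed with the affine line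
`ζ ↦ 1 + ζ N`, which maps the disc into the cone-open). [cite: Borel1997, §5.14] -/
theorem IsConeHol.differentiableOn_line {N : Matrix (Fin 2) (Fin 2) ℂ}
    (hNv : N *ᵥ 𝔣.v₀ = 𝔣.t₀) (hNN : N * N = 0) {Φ : Matrix (Fin 2) (Fin 2) ℂ → ℂ} (hΦ : IsConeHol 𝔣 Φ) :
    DifferentiableOn ℂ (fun ζ : ℂ => Φ (1 + ζ • N))
      {ζ : ℂ | ζ • 𝔣.t₀ + (1 : ℂ) • 𝔣.v₀ ∈ negCone (J.map w₁.1.embedding)} := by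
  set D : Set ℂ := {ζ : ℂ | ζ • 𝔣.t₀ + (1 : ℂ) • 𝔣.v₀ ∈ negCone (J.map w₁.1.embedding)} with hD
  have hι : Differentiable ℂ (fun ζ : ℂ =>
      Matrix.of.symm (1 : Matrix (Fin 2) (Fin 2) ℂ) + ζ • Matrix.of.symm N) :=
    (differentiable_const _).add (differentiable_id.smul_const _)
  have hmaps : Set.MapsTo (fun ζ : ℂ => Matrix.of.symm (1 : Matrix (Fin 2) (Fin 2) ℂ) + ζ • Matrix.of.symm N) D
      {g : Fin 2 → Fin 2 → ℂ | IsUnit (Matrix.of g) ∧ Matrix.of g *ᵥ 𝔣.v₀ ∈ negCone (J.map w₁.1.embedding)} := by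
    intro ζ hζ
    have hof : Matrix.of (Matrix.of.symm (1 : Matrix (Fin 2) (Fin 2) ℂ) + ζ • Matrix.of.symm N) = 1 + ζ • N := rfl
    simp only [Set.mem_setOf_eq, hof, line_mulVec_v₀ hNv]
    exact ⟨isUnit_line hNN ζ, hζ⟩
  have hcomp := hΦ.1.comp (hι.differentiableOn (s := D)) hmaps
  refine hcomp.congr fun ζ _ => ?_
  simp only [Function.comp_apply]
  rfl

/-- `F` is holomorphic on a neighbourhood of every closed disc `|ζ| ≤ |ζ₀|` with `v₀ + ζ₀ t₀` negative (`DiffContOnCl`, the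
hypothesis of Mathlib's circle mean value theorem). [cite: Borel1997, §5.14] -/
theorem IsConeHol.diffContOnCl_line (hvt : star 𝔣.v₀ ⬝ᵥ (J.map w₁.1.embedding *ᵥ 𝔣.t₀) = 0)
    {N : Matrix (Fin 2) (Fin 2) ℂ} (hNv : N *ᵥ 𝔣.v₀ = 𝔣.t₀) (hNN : N * N = 0) {Φ : Matrix (Fin 2) (Fin 2) ℂ → ℂ} (hΦ : IsConeHol 𝔣 Φ)
    {ζ₀ : ℂ} (h₀ : ζ₀ • 𝔣.t₀ + (1 : ℂ) • 𝔣.v₀ ∈ negCone (J.map w₁.1.embedding)) :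
    DiffContOnCl ℂ (fun ζ : ℂ => Φ (1 + ζ • N)) (Metric.ball 0 |‖ζ₀‖|) := by
  refine DifferentiableOn.diffContOnCl ((hΦ.differentiableOn_line hNv hNN).mono ?_)
  intro ζ hζ
  have hζ' : ‖ζ‖ ≤ ‖ζ₀‖ := by
    have := Metric.closure_ball_subset_closedBall hζ
    rw [Metric.mem_closedBall, dist_zero_right, abs_norm] at this
    exact this
  exact line_mem_negCone_of_norm_le hvt h₀ hζ'

/-! ## §4 Smoothness of the frame coordinates; the determinant in frame coordinates -/

/-- The frame coordinates `g ↦ π((of g) w)` are smooth (they are `ℂ`-linear). [cite: Borel1997, §5.13] -/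
theorem contDiff_frameCoord (π : (Fin 2 → ℂ) →ₗ[ℂ] ℂ) (w : Fin 2 → ℂ) {n : WithTop ℕ∞} :
    ContDiff ℝ n (fun g : Fin 2 → Fin 2 → ℂ => π (Matrix.of g *ᵥ w)) := by
  let L : (Fin 2 → Fin 2 → ℂ) →ₗ[ℂ] ℂ :=
    { toFun := fun g => π (Matrix.of g *ᵥ w)
      map_add' := fun g g' => by
        rw [show Matrix.of (g + g') = Matrix.of g + Matrix.of g' from rfl, add_mulVec, map_add]
      map_smul' := fun r g => by
        rw [show Matrix.of (r • g) = r • Matrix.of g from rfl, smul_mulVec, map_smul, RingHom.id_apply] }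
  have hL : ContDiff ℂ n (fun g : Fin 2 → Fin 2 → ℂ => π (Matrix.of g *ᵥ w)) := L.toContinuousLinearMap.contDiff
  exact hL.restrict_scalars ℝ

/-- The frame coordinates `M ↦ π(M w)` are continuous on `M₂(ℂ)`. [cite: Borel1997, §5.13] -/
theorem continuous_frameCoord (π : (Fin 2 → ℂ) →ₗ[ℂ] ℂ) (w : Fin 2 → ℂ) :
    Continuous (fun M : Matrix (Fin 2) (Fin 2) ℂ => π (M *ᵥ w)) :=
  (contDiff_frameCoord π w (n := 0)).continuous

/-- **An invertible matrix has non-zero frame determinant `x y′ − x′ y`** (`h v₀ = y t₀ + x v₀`, `h t₀ = y′ t₀ + x′ v₀`): otherwise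
`x t₀ − x′ v₀ ≠ 0` (here `x ≠ 0`) lies in the kernel. [cite: Jacobson, Ch. V §7 pp. 150–151] -/
theorem frameDet_ne_zero (hvt : star 𝔣.v₀ ⬝ᵥ (J.map w₁.1.embedding *ᵥ 𝔣.t₀) = 0) {πt πv : (Fin 2 → ℂ) →ₗ[ℂ] ℂ}
    (hdec : ∀ w, w = πt w • 𝔣.t₀ + πv w • 𝔣.v₀) {h : Matrix (Fin 2) (Fin 2) ℂ} (hu : IsUnit h)
    (hx : πv (h *ᵥ 𝔣.v₀) ≠ 0) :
    πv (h *ᵥ 𝔣.v₀) * πt (h *ᵥ 𝔣.t₀) - πv (h *ᵥ 𝔣.t₀) * πt (h *ᵥ 𝔣.v₀) ≠ 0 := by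
  intro hD
  set x := πv (h *ᵥ 𝔣.v₀)
  set y := πt (h *ᵥ 𝔣.v₀)
  set x' := πv (h *ᵥ 𝔣.t₀)
  set y' := πt (h *ᵥ 𝔣.t₀)
  have hker : h *ᵥ (x • 𝔣.t₀ + (-x') • 𝔣.v₀) = 0 := by
    rw [mulVec_add, mulVec_smul, mulVec_smul, hdec (h *ᵥ 𝔣.t₀), hdec (h *ᵥ 𝔣.v₀)]
    have h1 : x * y' + -x' * y = 0 := by rw [← hD]; ring
    have h2 : x * x' + -x' * x = 0 := by ring
    calc x • (y' • 𝔣.t₀ + x' • 𝔣.v₀) + -x' • (y • 𝔣.t₀ + x • 𝔣.v₀)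
        = (x * y' + -x' * y) • 𝔣.t₀ + (x * x' + -x' * x) • 𝔣.v₀ := by
          simp only [smul_add, smul_smul, add_smul]; abel
      _ = 0 := by rw [h1, h2, zero_smul, zero_smul, add_zero]
  have hdet : h.det ≠ 0 := ((Matrix.isUnit_iff_isUnit_det h).1 hu).ne_zero
  have hzero := Matrix.eq_zero_of_mulVec_eq_zero hdet hker
  have hx0 : x = 0 := ((LinearIndependent.pair_iff.1 (frame_linearIndependent 𝔣 hvt)) _ _ hzero).1
  exact hx hx0

end Literature.NumberTheory.Automorphic.UnitaryCurveForms

end
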